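import Summits.AnomalousDissipation.AnomalousDissipation.Theorems.TwohalfdNeg.Negative.LaminarShear
import Summits.AnomalousDissipation.AnomalousDissipation.Theorems.ScalarAnomalySteadySourceFormal.Negative.HeatProfile
import Literature.Analysis.FluidPDE.LongTimeAverageNonneg

/-!
# Negative knowledge for the crux `TwohalfdNeg` (stmt-AnomalousDissipation-0211), V: cheap probes of the
# stub set of the picked line `log-kantorovich-enstrophy-transfer` (drefute)

The picked line (`Cruxes/TwohalfdNeg/Lines/log-kantorovich-enstrophy-transfer.lean`) splits the crux into
S1 `stub_reduction`, S2 `stub_planarNoAnomaly`, S3 `stub_ageDecoupling`, S4 `stub_releaseLogBound`,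
S5 `stub_quietOfSubLog`, S6 `stub_subLogStrain`.  Two certified probe facts:

* `planarBundle_satisfiable` / `meanDissipation_restFlow`: the common planar hypothesis bundle of S2 / S5 / S6
  (smooth solenoidal mean-zero steady `g`, `ν_j → 0⁺`, global Leray–Hopf `v_j`, `ν`-uniform mean-energy bound)
  is inhabited by the flow at rest under `g = 0` (so those stubs are not vacuous), and the conclusion of S2 holds
  on that inhabitant (mean dissipation `0`);
* `stubAgeDecoupling_false_without_quiet`: S3 with its finite-window-quiet hypothesis DELETED (everything else
  verbatim) is FALSE — witness the rest flow, the source `h = cos(2πx₀)`, `ν_j = 1` and the steady heat profile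
  `θ_j = h/(4π²)` (a global weak sourced solution with honest bounded variance and honest constant dissipation
  `1/(8π²)`), so the quiet hypothesis is load-bearing in S3 (and S3 needs no `ν_j → 0`, which it indeed omits).

Tool kit reused: `isGlobalLerayHopf_rest`, `meanEnergy_rest`, `heatProfile_isWeak`,
`longTimeAvgSup_scalarL2Sq_heatProfile`, `longTimeAvgSup_dissipation_heatProfile`
(`Theorems/ScalarAnomalySteadySourceFormal/Negative/HeatProfile.lean`) and `isSmooth_zero₂`, `hasZeroMean_zero₂`,
`gradNormSq_zero₂` (`Negative/LaminarShear.lean`).  Supports stmt-AnomalousDissipation-0211.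
-/

set_option linter.dupNamespace false

noncomputable section

namespace Summit.AnomalousDissipation.AnomalousDissipation.Theorems.TwohalfdNeg.Negative

open MeasureTheory Set Filter Topology UnitAddTorus
open scoped ENNReal NNReal InnerProductSpace
open Literature.Analysis.FunctionSpaces Literature.Analysis.FunctionSpaces.Torus
open Literature.Analysis.FluidPDE Literature.Analysis.FluidPDE.Torus
open Summit.AnomalousDissipation.AnomalousDissipation.Theorems.ScalarAnomalySteadySourceFormal.Negative
  (isGlobalLerayHopf_rest meanEnergy_rest cosMode isSmooth_cosMode hasZeroMean_cosMode axialFreq axialFreq_ne_zero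
    lam lam_pos_axialFreq heatProfile heatProfile_isWeak memLp_heatProfile longTimeAvgSup_scalarL2Sq_heatProfile
    longTimeAvgSup_dissipation_heatProfile)

/-! ## 7. Probes of the stub set of `log-kantorovich-enstrophy-transfer` -/

section StubProbes

/-- The planar flow at rest, `v(t, x) = 0`. [folklore] -/
abbrev restFlow : ℝ → (UnitAddTorus (Fin 2)) → (EuclideanSpace ℝ (Fin 2)) := fun _ _ => 0

/-- The zero planar field is divergence free. [folklore] -/
theorem isDivFree_zero₂ : IsDivFree (fun _ : (UnitAddTorus (Fin 2)) => (0 : (EuclideanSpace ℝ (Fin 2)))) :=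
  fun x => divergence_zero x

/-- **Non-vacuity of the planar hypothesis bundle of S2 / S5 / S6.** With `g = 0`, `ν_j = 1/(j+1)`,
zero data and the flow at rest: `g` is smooth, solenoidal, mean zero; `ν_j → 0⁺`; every `v_j` is a
global Leray–Hopf solution; the mean energies are bounded by `E = 0` (honest: `meanEnergy_rest`). [folklore] -/
theorem planarBundle_satisfiable :
    ∃ (g : (UnitAddTorus (Fin 2)) → (EuclideanSpace ℝ (Fin 2))) (ν : ℕ → ℝ)
      (v₀ : ℕ → (UnitAddTorus (Fin 2)) → (EuclideanSpace ℝ (Fin 2)))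
      (v : ℕ → ℝ → (UnitAddTorus (Fin 2)) → (EuclideanSpace ℝ (Fin 2))),
      IsSmooth g ∧ IsDivFree g ∧ HasZeroMean g ∧ (∀ j, 0 < ν j) ∧ Tendsto ν atTop (𝓝 0) ∧
      (∀ j, IsGlobalLerayHopf (ν j) (fun _ => g) (v₀ j) (v j)) ∧ (∃ E : ℝ, ∀ j, meanEnergy (v j) ≤ E) := by
  refine ⟨fun _ => 0, fun j => 1 / ((j : ℝ) + 1), fun _ _ => 0, fun _ => restFlow, isSmooth_const _,
    isDivFree_zero₂, ?_, fun j => by positivity, tendsto_one_div_add_atTop_nhds_zero_nat,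
    fun j => isGlobalLerayHopf_rest _, 0, fun j => ?_⟩
  · exact hasZeroMean_zero₂
  · rw [show (restFlow : ℝ → (UnitAddTorus (Fin 2)) → (EuclideanSpace ℝ (Fin 2))) = fun _ _ => 0 from rfl,
      meanEnergy_rest]

/-- … and the conclusion of S2 holds on that inhabitant: the flow at rest dissipates nothing, at every
viscosity (honest constant Cesàro means). [folklore] -/
theorem meanDissipation_restFlow (ν : ℝ) : meanDissipation ν restFlow = 0 := by
  unfold meanDissipation
  have : (fun t : ℝ => ν * (eGradNormSq (restFlow t)).toReal) = fun _ => 0 := by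
    funext t
    have h0 : eGradNormSq (restFlow t) = 0 := by
      rw [show restFlow t = (0 : (UnitAddTorus (Fin 2)) → (EuclideanSpace ℝ (Fin 2))) from rfl,
        eGradNormSq_eq_ofReal_gradNormSq isSmooth_zero₂, gradNormSq_zero₂, ENNReal.ofReal_zero]
    rw [h0]; simp
  rw [this]
  exact longTimeAvgSup_const_fun 0

/-- S3 `stub_ageDecoupling` of the line `log-kantorovich-enstrophy-transfer` with its FINITE-WINDOW-QUIET
hypothesis deleted (every other binder and hypothesis verbatim): "every steadily sourced weak scalar over a
steadily forced planar Leray–Hopf family with `ν`-uniformly bounded mean variance has mean dissipation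
`⟨ν_j‖∇θ_j‖²⟩ → 0`" (a local mutation of the stub, stated here only to be refuted below; not a literature
fact). -/
def StubAgeDecouplingWithoutQuiet : Prop :=
    ∀ (g : (UnitAddTorus (Fin 2)) → (EuclideanSpace ℝ (Fin 2))) (h : (UnitAddTorus (Fin 2)) → ℝ),
      IsSmooth g → IsDivFree g → HasZeroMean g →
      IsSmooth h → HasZeroMean h →
      ∀ (ν : ℕ → ℝ) (v₀ : ℕ → (UnitAddTorus (Fin 2)) → (EuclideanSpace ℝ (Fin 2)))
        (v : ℕ → ℝ → (UnitAddTorus (Fin 2)) → (EuclideanSpace ℝ (Fin 2)))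
        (θ₀ : ℕ → (UnitAddTorus (Fin 2)) → ℝ) (θ : ℕ → ℝ → (UnitAddTorus (Fin 2)) → ℝ),
        (∀ j, 0 < ν j) →
        (∀ j, IsGlobalLerayHopf (ν j) (fun _ => g) (v₀ j) (v j)) →
        (∀ j, MemLp (θ₀ j) 2 volume) →
        (∀ j, IsWeakScalarTransportForced (ν j) (v j) (fun _ => h) (θ₀ j) (θ j)) →
        (∃ E : ℝ, ∀ j, longTimeAvgSup (fun t => scalarL2Sq (θ j t)) ≤ E) →
        Tendsto (fun j => longTimeAvgSup
          (fun t => ν j * (eScalarGradNormSq (θ j t)).toReal)) atTop (𝓝 0)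

/-- **The finite-window-quiet hypothesis of S3 is load-bearing.** Witness: `g = 0` and the flow at rest,
the one-mode source `h = cos(2πx₀)`, constant viscosity `ν_j = 1` (S3 carries no `ν_j → 0`), and the steady
heat profile `θ_j = h/(4π²)` from its own datum: a global weak sourced solution (`heatProfile_isWeak`) with
honest bounded mean variance `1/(32π⁴)` and honest constant mean dissipation `1/(8π²) ≠ 0`.  (Consistently, its
releases are NOT quiet: the heat release of `h` loses the fixed fraction `1 - e^{-8π²S}` of its variance in every
window of length `S`.) [folklore] -/
theorem stubAgeDecoupling_false_without_quiet : ¬ StubAgeDecouplingWithoutQuiet := by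
  intro H
  have hk : axialFreq 1 ≠ 0 := axialFreq_ne_zero one_ne_zero
  have hlam : lam (axialFreq 1) ≠ 0 := (lam_pos_axialFreq one_ne_zero).ne'
  have ht := H (fun _ => 0) (cosMode (axialFreq 1) 1) (isSmooth_const _) isDivFree_zero₂ hasZeroMean_zero₂
    (isSmooth_cosMode _ _) (hasZeroMean_cosMode hk 1) (fun _ => 1) (fun _ _ => 0) (fun _ => restFlow)
    (fun _ => heatProfile (axialFreq 1) 1 1) (fun _ _ => heatProfile (axialFreq 1) 1 1)
    (fun _ => one_pos) (fun _ => isGlobalLerayHopf_rest 1) (fun _ => memLp_heatProfile _ _ _)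
    (fun _ => heatProfile_isWeak hlam one_ne_zero 1)
    ⟨(1 / (1 * lam (axialFreq 1))) ^ 2 / 2, fun _ => (longTimeAvgSup_scalarL2Sq_heatProfile hk 1 1).le⟩
  have hconst : (fun _ : ℕ => longTimeAvgSup
      (fun _ : ℝ => (1 : ℝ) * (eScalarGradNormSq (heatProfile (axialFreq 1) 1 1)).toReal)) =
      fun _ => 1 ^ 2 / (2 * (1 * lam (axialFreq 1))) := by
    funext j
    exact longTimeAvgSup_dissipation_heatProfile hk hlam one_ne_zero 1
  rw [hconst, tendsto_const_nhds_iff] at ht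
  have hpos : 0 < (1 : ℝ) ^ 2 / (2 * (1 * lam (axialFreq 1))) := by
    have := lam_pos_axialFreq (n := 1) one_ne_zero
    positivity
  exact hpos.ne' ht

end StubProbes

end Summit.AnomalousDissipation.AnomalousDissipation.Theorems.TwohalfdNeg.Negative
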